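import Literature.AnabelianGeometry.EtaleTheta.SettingModelChiTwist
import Literature.AnabelianGeometry.EtaleTheta.SettingModel2Inversion
import Mathlib.GroupTheory.SemidirectProduct
import HarnessLib

/-!
# The χ-twisted root model, inversion layer: `σ̂` commutes with the `Ẑ^×`-twist, and the inversion of `Γ ⋊_{χ} G`

S. Mochizuki, *The étale theta function and its Frobenioid-theoretic manifestations*, Publ. RIMS **45** (2009) [EtTh], §1
p. 12 (PRIMS p. 238) («`Δ_X` … a profinite free group on 2 generators», the cyclotomes `Δ_Θ ≅ Ẑ(1)`, `(Δ^tp_Y)^ell ≅ Ẑ(1)`);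
§2 p. 36 (PRIMS p. 262) «`ι` … “multiplication by `−1`”», Prop. 2.2 (i) p. 37; [IUTchII] Rmk. 1.4.1 (ii) p. 28 (the pointed
inversion is an automorphism OVER `G_k`). [cite: MochizukiEtTh2009, §2 p.36]

Cell abc-iut, seat abc-iut-w5-d072 (gen 3; (R1) ι-datum custody; OFFER 05:49:39Z to the R78 cluster of abc-iut-L2-lead's
RULINGS #13). The χ-TWISTED root model (abc-iut-L6-d6 / abc-iut-L2-t1 / abc-iut-w5-d024 / abc-iut-w5-d249 / abc-iut-L2-d1,
files F2 `SettingModelChiTwist` ✓, F4/F5 in flight) takes `Π^tp_X := Γ ⋊_{θ ∘ χ} G_{ℚ_p}` with `Γ = F̂₂ ×_Ẑ ℤ` and the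
`Ẑ^×`-twist `θ_φ : a ↦ a, b ↦ b^{φ(1)}` of abc-iut-w5-d024 (`twist`, `twistGfp : MulAut Ẑ →* MulAut Γ`). For the pointed
inversion of that model to exist as an automorphism OVER `G_{ℚ_p}` one needs exactly that the inversion of `Γ` COMMUTES with
the twist. This file proves it and builds the inversion of every twisted semidirect product `Γ ⋊_{θ ∘ ψ} G` — carrier-generic
in `(G, ψ : G →* Aut Ẑ)`, so it applies verbatim to F4's `PiTpχ p := Γ ⋊[twistGfp.comp chi] G_{ℚ_p}`:

* §1 `sigmaHat_bPow : σ̂(b^t) = (b^t)⁻¹` (density of `ℤ` in `Ẑ`), **`sigmaHat_twist : σ̂ ∘ θ_φ = θ_φ ∘ σ̂`** (abc-iut-w5-d024's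
  uniqueness principle `ext_of_eta`: both sides are continuous homomorphisms `F̂₂ → F̂₂` with `η a ↦ η a⁻¹`,
  `η b ↦ (b^{φ(1)})⁻¹`), **`gfpInv_twistGfp : ι_Γ ∘ twistGfp φ = twistGfp φ ∘ ι_Γ`** on `Γ` (`ι_Γ = gfpInv` of
  `SettingModel2Inversion.lean`, p428141: `(x, n) ↦ (σ̂ x, n⁻¹)`).
* §2 for ANY group `G` and `ψ : G →* Aut(Ẑ)`: **`twistedInversion ψ : (Γ ⋊[twistGfp.comp ψ] G) ≃* (Γ ⋊[twistGfp.comp ψ] G)`**,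
  `(γ, g) ↦ (ι_Γ γ, g)` (Mathlib `SemidirectProduct.congr` with the commutation of §1) — an involution
  (`twistedInversion_twistedInversion`), OVER `G` (`rightHom_twistedInversion`), restricting to `ι_Γ` on `Γ`
  (`twistedInversion_inl`), reversing the degree `Γ ↠ ℤ` of the normal factor (`gfpSnd_left_twistedInversion`), nontrivial
  (`twistedInversion_ne_refl`); and CONTINUOUS for any topology on the semidirect product induced by `g ↦ (g.left, g.right)`
  (`continuous_twistedInversion`), packaged as `twistedInversionTop`.

So the (R1) datum of the χ-twisted model is available the moment its carrier is named: `ι_χ := twistedInversion chi` (hΔ from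
«over `G`», (R1c) from the degree reversal, (R1e′) via `Discharge/Sec1InversionTemperedCriterion.lean` p427478 or the
`completionAut` comparison of `SettingModel2Inversion.lean`). HONEST LIMITS: model plumbing, consistency evidence only
(semi-synthetic root models); nothing of [EtTh] is asserted; no side is taken on [IUTchIII] Cor. 3.12; typed ≠ proved.
Definitions: `twistedInversion`, `twistedInversionTop` (no instances, no Prop facts).
-/

noncomputable section

namespace Literature.AnabelianGeometry.EtaleTheta.SettingModel

open Literature.AnabelianGeometry.SemiGraphs
open Function
open _root_.Topology

/-! ## §1. `σ̂` commutes with the `Ẑ^×`-twist -/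

/-- `ι : ℤ → Ẑ` has dense range. [cite: MochizukiEtTh2009, §1 p.12] -/
theorem denseRange_iotaZ : DenseRange (iotaZ : Multiplicative ℤ → ZH) :=
  ProfiniteGrp.ProfiniteCompletion.denseRange (G := GrpCat.of (Multiplicative ℤ))

/-- **`σ̂ (b^t) = (b^t)⁻¹`** for `t ∈ Ẑ` (on `ι(ℤ)`: `σ̂(η b^k) = η(b⁻¹)^k`; both sides continuous in `t`).
[cite: MochizukiEtTh2009, §2 p.36] -/
theorem sigmaHat_bPow (t : ZH) : sigmaHat (bPow t) = (bPow t)⁻¹ := by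
  have h : (sigmaHat ∘ bPow : ZH → F₂hatT) = fun t => (bPow t)⁻¹ :=
    Continuous.ext_on denseRange_iotaZ (sigmaHat.continuous.comp bPow.continuous) bPow.continuous.inv
      (by
        rintro _ ⟨k, rfl⟩
        simp only [comp_apply]
        rw [bPow_iotaZ, map_zpow, sigmaHat_eta, invGenHom_of, map_inv, inv_zpow])
  exact congrFun h t

/-- **`σ̂ ∘ θ_φ = θ_φ ∘ σ̂`**: the completed inversion commutes with every `Ẑ^×`-twist of `F̂₂` (check on the generators:
`η a ↦ η a⁻¹`, `η b ↦ (b^{φ(1)})⁻¹` on both sides; uniqueness `ext_of_eta`). [cite: MochizukiEtTh2009, §2 p.36] -/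
theorem sigmaHat_twist (φ : MulAut ZH) (x : F₂hatT) : sigmaHat (twist φ x) = twist φ (sigmaHat x) := by
  let f : F₂hatT →ₜ* F₂hatT :=
    { toMonoidHom := sigmaHat.toMonoidHom.comp (twist φ).toMulEquiv.toMonoidHom
      continuous_toFun := sigmaHat.continuous.comp (twist φ).continuous }
  let f' : F₂hatT →ₜ* F₂hatT :=
    { toMonoidHom := (twist φ).toMulEquiv.toMonoidHom.comp sigmaHat.toMonoidHom
      continuous_toFun := (twist φ).continuous.comp sigmaHat.continuous }
  have hff' : f = f' := by
    refine ext_of_eta ?_ ?_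
    · change sigmaHat (twist φ (eta (FreeGroup.of 0))) = twist φ (sigmaHat (eta (FreeGroup.of 0)))
      rw [twist_eta_of_zero, sigmaHat_eta, invGenHom_of, map_inv, map_inv, twist_eta_of_zero]
    · change sigmaHat (twist φ (eta (FreeGroup.of 1))) = twist φ (sigmaHat (eta (FreeGroup.of 1)))
      rw [twist_eta_of_one, sigmaHat_bPow, sigmaHat_eta, invGenHom_of, map_inv, map_inv, twist_eta_of_one]
  exact DFunLike.congr_fun (congrArg ContinuousMonoidHom.toMonoidHom hff') x

/-- **`ι_Γ ∘ twistGfp φ = twistGfp φ ∘ ι_Γ`** on `Γ = F̂₂ ×_Ẑ ℤ`. [cite: MochizukiEtTh2009, §2 p.36] -/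
theorem gfpInv_twistGfp (φ : MulAut ZH) (γ : Gfp) : gfpInv (twistGfp φ γ) = twistGfp φ (gfpInv γ) :=
  Subtype.ext (Prod.ext (sigmaHat_twist φ _) rfl)

/-- The commutation as an identity of automorphisms of `Γ` (the hypothesis of `SemidirectProduct.congr`).
[cite: MochizukiEtTh2009, §2 p.36] -/
theorem twistGfp_trans_gfpInv (φ : MulAut ZH) :
    (twistGfp φ).trans gfpInv.toMulEquiv = gfpInv.toMulEquiv.trans (twistGfp φ) :=
  MulEquiv.ext fun γ => gfpInv_twistGfp φ γ

/-! ## §2. The inversion of a twisted semidirect product `Γ ⋊_{θ ∘ ψ} G` -/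

section Twisted

variable {G : Type*} [Group G] (ψ : G →* MulAut ZH)

/-- **The inversion of `Γ ⋊_{θ ∘ ψ} G`**: `(γ, g) ↦ (ι_Γ γ, g)` — a group automorphism because `ι_Γ` commutes with the
twist; OVER `G` ([IUTchII] Rmk. 1.4.1 (ii)). Generic in `(G, ψ)`: for the χ-twisted root model take `G := G_{ℚ_p}`,
`ψ := χ`. DEFINED. [cite: Mochizuki2012, Rmk 1.4.1 (ii) p.28] -/
def twistedInversion : (Gfp ⋊[twistGfp.comp ψ] G) ≃* (Gfp ⋊[twistGfp.comp ψ] G) :=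
  SemidirectProduct.congr gfpInv.toMulEquiv (MulEquiv.refl G) fun g => twistGfp_trans_gfpInv (ψ g)

/-- [cite: Mochizuki2012, Rmk 1.4.1 (ii) p.28] -/
@[simp] theorem twistedInversion_left (x : Gfp ⋊[twistGfp.comp ψ] G) : (twistedInversion ψ x).left = gfpInv x.left := rfl

/-- [cite: Mochizuki2012, Rmk 1.4.1 (ii) p.28] -/
@[simp] theorem twistedInversion_right (x : Gfp ⋊[twistGfp.comp ψ] G) : (twistedInversion ψ x).right = x.right := rfl

/-- **The inversion is an involution.** [cite: MochizukiEtTh2009, §2 p.36] -/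
@[simp] theorem twistedInversion_twistedInversion (x : Gfp ⋊[twistGfp.comp ψ] G) :
    twistedInversion ψ (twistedInversion ψ x) = x :=
  SemidirectProduct.ext (gfpInvFun_gfpInvFun x.left) rfl

/-- **The inversion is over `G`**: `rightHom ∘ ι = rightHom`. [cite: Mochizuki2012, Rmk 1.4.1 (ii) p.28] -/
theorem rightHom_twistedInversion (x : Gfp ⋊[twistGfp.comp ψ] G) :
    SemidirectProduct.rightHom (twistedInversion ψ x) = SemidirectProduct.rightHom x := rfl

/-- On the normal factor the inversion is `ι_Γ`: `ι (inl γ) = inl (ι_Γ γ)`. [cite: MochizukiEtTh2009, §2 p.36] -/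
theorem twistedInversion_inl (γ : Gfp) :
    twistedInversion ψ (SemidirectProduct.inl γ) = SemidirectProduct.inl (gfpInv γ) :=
  SemidirectProduct.ext rfl rfl

/-- The inversion fixes the complement: `ι (inr g) = inr g`. [cite: Mochizuki2012, Rmk 1.4.1 (ii) p.28] -/
theorem twistedInversion_inr (g : G) :
    twistedInversion ψ (SemidirectProduct.inr g) = SemidirectProduct.inr g :=
  SemidirectProduct.ext (by change gfpInv 1 = 1; exact map_one _) rfl

/-- **Degree reversal**: the inversion negates the degree `Γ ↠ ℤ` of the normal factor, `pr₂ (ι x).left = (pr₂ x.left)⁻¹`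
(the `Z`-quotient of the twisted model is `pr₂ ∘ left`, fixed by the twist). [cite: Mochizuki2012, Prop 2.2 (ii) p.66] -/
theorem gfpSnd_left_twistedInversion (x : Gfp ⋊[twistGfp.comp ψ] G) :
    gfpSnd (twistedInversion ψ x).left = (gfpSnd x.left)⁻¹ := rfl

/-- **The inversion is nontrivial** (it moves `inl (a)`: the degree of `a` is `1 ≠ −1`). [cite: MochizukiEtTh2009, §2 p.36] -/
theorem twistedInversion_ne_refl : twistedInversion ψ ≠ MulEquiv.refl _ := by
  intro h
  have h1 := gfpSnd_left_twistedInversion ψ (SemidirectProduct.inl (gfpOf (FreeGroup.of 0)))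
  rw [h] at h1
  change expA (FreeGroup.of 0) = (expA (FreeGroup.of 0))⁻¹ at h1
  rw [expA_apply, heisHom_of_zero, ← ofAdd_neg] at h1
  have h2 : (1 : ℤ) = -1 := Multiplicative.ofAdd.injective h1
  omega

/-- **Continuity**: for any topology on `Γ ⋊ G` INDUCED by `g ↦ (g.left, g.right)` (the product topology transported —
the shape announced for F4's carrier), the inversion is continuous. [cite: MochizukiEtTh2009, §2 p.36] -/
theorem continuous_twistedInversion [TopologicalSpace G] [TopologicalSpace (Gfp ⋊[twistGfp.comp ψ] G)]
    (hind : IsInducing fun g : Gfp ⋊[twistGfp.comp ψ] G => (g.left, g.right)) :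
    Continuous (twistedInversion ψ) := by
  rw [hind.continuous_iff]
  have h : ((fun g : Gfp ⋊[twistGfp.comp ψ] G => (g.left, g.right)) ∘ twistedInversion ψ) =
      Prod.map gfpInv id ∘ fun g : Gfp ⋊[twistGfp.comp ψ] G => (g.left, g.right) := by
    funext g; rfl
  rw [h]
  exact (gfpInv.continuous.prodMap continuous_id).comp hind.continuous

/-- **The inversion as a TOPOLOGICAL automorphism** of `Γ ⋊ G` (topology induced by `(left, right)`).
[cite: Mochizuki2012, Rmk 1.4.1 (ii) p.28] -/
def twistedInversionTop [TopologicalSpace G] [TopologicalSpace (Gfp ⋊[twistGfp.comp ψ] G)]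
    (hind : IsInducing fun g : Gfp ⋊[twistGfp.comp ψ] G => (g.left, g.right)) :
    (Gfp ⋊[twistGfp.comp ψ] G) ≃ₜ* (Gfp ⋊[twistGfp.comp ψ] G) where
  toMulEquiv := twistedInversion ψ
  continuous_toFun := continuous_twistedInversion ψ hind
  continuous_invFun := by
    have h : ((twistedInversion ψ).symm : Gfp ⋊[twistGfp.comp ψ] G → _) = twistedInversion ψ := by
      funext x
      apply (twistedInversion ψ).injective
      rw [MulEquiv.apply_symm_apply, twistedInversion_twistedInversion]
    change Continuous ((twistedInversion ψ).symm : Gfp ⋊[twistGfp.comp ψ] G → _)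
    rw [h]
    exact continuous_twistedInversion ψ hind

/-- [cite: Mochizuki2012, Rmk 1.4.1 (ii) p.28] -/
@[simp] theorem twistedInversionTop_apply [TopologicalSpace G] [TopologicalSpace (Gfp ⋊[twistGfp.comp ψ] G)]
    (hind : IsInducing fun g : Gfp ⋊[twistGfp.comp ψ] G => (g.left, g.right)) (x : Gfp ⋊[twistGfp.comp ψ] G) :
    twistedInversionTop ψ hind x = twistedInversion ψ x := rfl

end Twisted

end Literature.AnabelianGeometry.EtaleTheta.SettingModel

end
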